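import Literature.AlgebraicGeometry.HodgeTheory.LefschetzOneOneProofs
import HarnessLib

/-!
# GAGA dimension comparison for analytifications of smooth projective varieties (named fact)

Topic `Literature/AlgebraicGeometry/HodgeTheory` (companion of `chow_analyticSet_analytification`
in `LefschetzOneOneProofs.lean`). Serre, *Géométrie algébrique et géométrie analytique*, Ann. Inst.
Fourier 6 (1956), §6 (after Prop. 3, printed p. 11):

* Cor. 2: «Les anneaux `𝒪_x` et `ℋ_x` ont même dimension» — the algebraic and the analytic local
  rings of an algebraic variety at a point have the same Krull dimension;
* Cor. 3: «Si `X` est une variété algébrique irréductible de dimension `r`, l'espace analytique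
  `X^h` est de dimension analytique `r` en chacun de ses points».

Vendored here, AS A RENDERING in the tree's vocabulary, in the one form the Hodge files consume:
for `X` smooth projective of dimension `n` over `ℂ`, an analytification `φ : M → X(ℂ)`
(`Literature.NumberTheory.Transcendental.IsAnalytification E X n φ`, `M` a complex manifold modelled
on `E ≅ ℂⁿ`) and a Zariski-closed `Z ⊆ X`, if every regular point of the closed analytic subset
`S = φ⁻¹(Z(ℂ))` of `M` (GAGA §5; `Literature.Geometry.Kaehler.regularLocus`,
`IsRegularPointOfCodim`) has complex codimension `≥ p` in `M`, then every scheme point of `Z` has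
codimension (`Order.coheight` in the specialisation order of `X`) `≥ p`. Derivation in print:
apply Cor. 3 to each irreducible component `Zᵢ` of `Z` — `Zᵢ(ℂ)^h` has analytic dimension
`dim Zᵢ` at every point, so at a regular point of `S` lying on `Zᵢ(ℂ)` only, the codimension in the
`n`-dimensional manifold `M` is `n − dim Zᵢ`, whence `dim Zᵢ ≤ n − p`; and in the irreducible,
catenary, `n`-dimensional scheme `X` a point `z ∈ Zᵢ` has `coheight z = n − dim (closure of z)
≥ n − dim Zᵢ ≥ p`. For `p = 1` the tree proves the needed instance directly
(`one_le_coheight_of_mem_of_isClosed_of_ne_univ`: proper closed subsets of an integral scheme have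
codimension `≥ 1`); the general case has no counterpart in the tree (`lean search` for
`coheight` × `IsRegularPointOfCodim` / analytification: nothing), and is exactly the hypothesis
`hr : ∀ z ∈ Z, (r : ℕ∞) ≤ Order.coheight z` of `mem_supportedClasses_of_restrictCompl_eq_zero`
(`AlgebraicClasses.lean`).

What is NOT here: the converse inequality and the equality of dimensions component by component
(only the inequality consumed downstream is stated); Cor. 2 on local rings as such; flatness
(Cor. 1). This fact grounds `Summit.HodgeConjecture.HodgeConjecture.Theses.HolomorphicityRate.AnalyticSupportAlgebraic`
(item stmt-HodgeConjecture-2741: with it the item is the `p`-general copy of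
`lefschetzOneOne_rational_of`).
-/

noncomputable section

open scoped Manifold ContDiff

namespace Literature.AlgebraicGeometry.HodgeTheory

/-- **GAGA dimension comparison** (Serre 1956, §6 Prop. 3 Cor. 2–3, p. 11: «Les anneaux `𝒪_x` et
`ℋ_x` ont même dimension»; «Si `X` est une variété algébrique irréductible de dimension `r`, l'espace
analytique `X^h` est de dimension analytique `r` en chacun de ses points»), rendered for the
analytification `φ : M → X(ℂ)` of a smooth projective `X` of dimension `n` over `ℂ` and a
Zariski-closed `Z ⊆ X`: if all regular points of the analytic set `φ⁻¹(Z(ℂ)) ⊆ M` have complex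
codimension `≥ p`, then all scheme points of `Z` have codimension (`Order.coheight`) `≥ p`
(componentwise: analytic dimension of `Zᵢ(ℂ)` = algebraic dimension of `Zᵢ`, and codimension is
`n −` dimension on both sides). Users take `(h : gaga_le_coheight_of_regularLocus_codim)`.
[cite: SerreGAGA1956, §6 Prop. 3 Cor. 2–3 (p. 11)] -/
def gaga_le_coheight_of_regularLocus_codim : Prop :=
  ∀ ⦃n : ℕ⦄ ⦃X : Motives.SchemeOver ℂ⦄, Motives.IsSmoothProjective n X →
    ∀ {E : Type} [NormedAddCommGroup E] [NormedSpace ℂ E] [FiniteDimensional ℂ E]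
      {M : Type} [TopologicalSpace M] [ChartedSpace E M] [IsManifold 𝓘(ℂ, E) ω M]
      {φ : M → Motives.ComplexPoints X},
      Literature.NumberTheory.Transcendental.IsAnalytification E X n φ →
        ∀ (p : ℕ) (Z : Set X.left), IsClosed Z →
          (∀ x ∈ Literature.Geometry.Kaehler.regularLocus 𝓘(ℂ, E) (φ ⁻¹' {P | P.pt ∈ Z}),
              ∀ q : ℕ, Literature.Geometry.Kaehler.IsRegularPointOfCodim 𝓘(ℂ, E)
                (φ ⁻¹' {P | P.pt ∈ Z}) q x → p ≤ q) →
            ∀ z ∈ Z, (p : ℕ∞) ≤ Order.coheight z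

end Literature.AlgebraicGeometry.HodgeTheory

end
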